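import Summits.QuantumFields.QCD.Theorems.PauliWegnerSeaFMClosureUnquenchedSideWitnessC1Aux8

/-!
# Side witness, part 10: ladders and the side witness on the complement of an odd ball

Crux `FMClosureUnquenched` (stmt-QuantumFields-11512), line `von-mises-circles`, registered sub-goal
`c1_sideWitness : SideWitness`.

The complement `(ball S x r)ᶜ` of the odd ball is the complement of the corner box `[0, q)⁴`,
`q = 2r+1` odd (corner `x + (-r, …, -r)`, Aux6), and `J = [q, 2S]` has even length.  The
supplementary system for its deficit sites (class `a ∈ {0, 1}`: coordinate `a ∈ J`, the others in
`I = [0, q)`) runs around the ladders `{q+2m, q+2m+1} × I` in the plane `(a, 2)`: up the even column,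
across at the top, down the odd column, across at the bottom (`ladder_flow`); fed into the complement
flow of Aux8 it gives `sideWitness_ball_compl` (= registered `c1_sideWitness_aux10`).
-/

namespace Summit.QuantumFields.QCD.Theorems.VonMisesCirclesC1

open Matrix Literature.MathematicalPhysics.QuantumLattice Literature.Probability.LatticeModels
open Summit.QuantumFields.QCD.Theorems.VonMisesCircles Literature.MathematicalPhysics.QuantumFieldTheory

set_option quotPrecheck false in
set_option hygiene false in
/-- The unit step `±e_μ` of label `ℓ = (μ, b)` on the torus of side `2S+1` (`STP`, to keep the
generic-`N` name `STEP` of parts 3–5 free). -/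
local notation "STP" ℓ:arg =>
  (if Prod.snd ℓ then -(Pi.single (Prod.fst ℓ) 1 : TorusSite 4 (2 * S + 1)) else Pi.single (Prod.fst ℓ) 1)

set_option quotPrecheck false in
set_option hygiene false in
/-- Offset coordinate `i` of the site `y` from the corner `c`, in `{0, …, 2S}`. -/
local notation "OFF" c:arg y:arg i:arg => (ZMod.val ((y : TorusSite 4 (2 * S + 1)) i - (c : TorusSite 4 (2 * S + 1)) i))

set_option quotPrecheck false in
/-- Out-label of the ladder cycles on `J × I` in the plane `(a, 2)` (`u ∈ J = [q, 2S]`, `t ∈ I = [0, q)`):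
up the column `t ↦ t+1` on even `u - q`, across at the top, down on odd `u - q`, across at the bottom. -/
local notation "LL" a:arg q:arg u:arg t:arg =>
  (if (u - q) % 2 = 0 then (if t + 1 < q then ((2, false) : Fin 4 × Bool) else ((a, false) : Fin 4 × Bool))
    else (if 0 < t then ((2, true) : Fin 4 × Bool) else ((a, true) : Fin 4 × Bool)))

set_option quotPrecheck false in
/-- In-label of the ladder cycles in the plane `(a, 2)`. -/
local notation "LEL" a:arg q:arg u:arg t:arg =>
  (if (u - q) % 2 = 0 then (if 0 < t then ((2, false) : Fin 4 × Bool) else ((a, true) : Fin 4 × Bool))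
    else (if t + 1 < q then ((2, true) : Fin 4 × Bool) else ((a, false) : Fin 4 × Bool)))

set_option quotPrecheck false in
/-- The reversed label. -/
local notation "REV" ℓ:arg => ((Prod.fst ℓ, !(Prod.snd ℓ)) : Fin 4 × Bool)

/-! ## One ladder system -/

/-- **The ladder cycles in the plane `(a, 2)`** (`q` odd, `3 ≤ q ≤ 2S`, `a ≠ 2`): out-move keeps
coordinate `a` in `J` and coordinate `2` in `I` and is undone by the reversed in-label of its target,
in-move likewise, and the in-label is never the reversed out-label. -/
theorem ladder_flow {S : ℕ} (c : TorusSite 4 (2 * S + 1)) {q : ℕ} (hq2 : q % 2 = 1) (hq3 : 3 ≤ q)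
    (hqS : q ≤ 2 * S) {a : Fin 4} (ha : a ≠ 2) (y : TorusSite 4 (2 * S + 1)) {u t : ℕ}
    (hyu : OFF c y a = u) (hyt : OFF c y 2 = t) (hu : q ≤ u) (ht : t < q) :
    (q ≤ OFF c (y + STP (LL a q u t)) a ∧ OFF c (y + STP (LL a q u t)) 2 < q ∧
      (∀ k : Fin 4, k ≠ a → k ≠ 2 → OFF c (y + STP (LL a q u t)) k = OFF c y k)) ∧
    (LEL a q (OFF c (y + STP (LL a q u t)) a) (OFF c (y + STP (LL a q u t)) 2) = LL a q u t) ∧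
    (q ≤ OFF c (y + STP (REV (LEL a q u t))) a ∧ OFF c (y + STP (REV (LEL a q u t))) 2 < q ∧
      (∀ k : Fin 4, k ≠ a → k ≠ 2 → OFF c (y + STP (REV (LEL a q u t))) k = OFF c y k)) ∧
    (LL a q (OFF c (y + STP (REV (LEL a q u t))) a) (OFF c (y + STP (REV (LEL a q u t))) 2) = LEL a q u t) ∧
    ((LL a q u t).1 = a ∨ (LL a q u t).1 = 2) ∧ ((LEL a q u t).1 = a ∨ (LEL a q u t).1 = 2) ∧
    (LEL a q u t ≠ REV (LL a q u t)) := by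
  have h2a : (2 : Fin 4) ≠ a := fun h => ha h.symm
  have huS : u < 2 * S + 1 := by rw [← hyu]; exact off_lt c y a
  -- the four neighbouring offsets
  have hup : t + 1 < q → OFF c (y + Pi.single 2 1) 2 = t + 1 := fun h => by
    rw [← hyt]; exact off_add_step_fwd c y 2 (by omega)
  have hupa : OFF c (y + Pi.single 2 1) a = u := by
    rw [← hyu]; exact off_add_step_of_ne c y ((2, false) : Fin 4 × Bool) ha
  have hdn : 0 < t → OFF c (y + -Pi.single 2 1) 2 = t - 1 := fun h => by
    rw [← hyt]; exact off_add_step_bwd c y 2 (by omega)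
  have hdna : OFF c (y + -Pi.single 2 1) a = u := by
    rw [← hyu]; exact off_add_step_of_ne c y ((2, true) : Fin 4 × Bool) ha
  have hrt : u + 1 < 2 * S + 1 → OFF c (y + Pi.single a 1) a = u + 1 := fun h => by
    rw [← hyu]; exact off_add_step_fwd c y a (by omega)
  have hrt2 : OFF c (y + Pi.single a 1) 2 = t := by
    rw [← hyt]; exact off_add_step_of_ne c y ((a, false) : Fin 4 × Bool) h2a
  have hlt : 0 < u → OFF c (y + -Pi.single a 1) a = u - 1 := fun h => by
    rw [← hyu]; exact off_add_step_bwd c y a (by omega)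
  have hlt2 : OFF c (y + -Pi.single a 1) 2 = t := by
    rw [← hyt]; exact off_add_step_of_ne c y ((a, true) : Fin 4 × Bool) h2a
  rcases Nat.mod_two_eq_zero_or_one (u - q) with hp | hp <;>
    by_cases h1 : t + 1 < q <;> by_cases h0 : 0 < t <;>
    simp only [hp, h1, h0, ↓reduceIte, Bool.not_true, Bool.not_false, Bool.false_eq_true, true_or, or_true,
      Nat.one_ne_zero]
  · -- even column, interior: up / from below
    have e1 := hup h1; have e2 := hdn h0
    have hp1 : (u - q) % 2 = 0 := hp
    refine ⟨⟨by omega, by omega, fun k hka hk2 => off_add_step_of_ne c y ((2, false) : Fin 4 × Bool) hk2⟩,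
      ?_, ⟨by omega, by omega, fun k hka hk2 => off_add_step_of_ne c y ((2, true) : Fin 4 × Bool) hk2⟩,
      ?_, trivial, trivial, by simp⟩
    · rw [hupa, e1]; simp [hp1, show 0 < t + 1 by omega]
    · rw [hdna, e2]; simp [hp1, show t - 1 + 1 < q by omega]
  · -- even column, bottom: up / from the right column
    have e1 := hup h1
    have hu1 : u + 1 < 2 * S + 1 := by omega
    have e2 := hrt hu1
    have hp1 : (u + 1 - q) % 2 = 1 := by omega
    refine ⟨⟨by omega, by omega, fun k hka hk2 => off_add_step_of_ne c y ((2, false) : Fin 4 × Bool) hk2⟩,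
      ?_, ⟨by omega, by omega, fun k hka hk2 => off_add_step_of_ne c y ((a, false) : Fin 4 × Bool) hka⟩,
      ?_, trivial, trivial, fun h => ha (congrArg Prod.fst h)⟩
    · rw [hupa, e1]; simp [hp, show 0 < t + 1 by omega]
    · rw [e2, hrt2]; simp [hp1, h0]
  · -- even column, top: across to the right column / from below
    have hu1 : u + 1 < 2 * S + 1 := by omega
    have e1 := hrt hu1; have e2 := hdn h0
    have hp1 : (u + 1 - q) % 2 = 1 := by omega
    refine ⟨⟨by omega, by omega, fun k hka hk2 => off_add_step_of_ne c y ((a, false) : Fin 4 × Bool) hka⟩,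
      ?_, ⟨by omega, by omega, fun k hka hk2 => off_add_step_of_ne c y ((2, true) : Fin 4 × Bool) hk2⟩,
      ?_, trivial, trivial, fun h => h2a (congrArg Prod.fst h)⟩
    · rw [e1, hrt2]; simp [hp1, h1]
    · rw [hdna, e2]; simp [hp, show t - 1 + 1 < q by omega]
  · -- even column, `q ≤ 1`: impossible
    omega
  · -- odd column, interior: down / from above
    have e1 := hdn h0; have e2 := hup h1
    refine ⟨⟨by omega, by omega, fun k hka hk2 => off_add_step_of_ne c y ((2, true) : Fin 4 × Bool) hk2⟩,
      ?_, ⟨by omega, by omega, fun k hka hk2 => off_add_step_of_ne c y ((2, false) : Fin 4 × Bool) hk2⟩,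
      ?_, trivial, trivial, by simp⟩
    · rw [hdna, e1]; simp [hp, show t - 1 + 1 < q by omega]
    · rw [hupa, e2]; simp [hp, show 0 < t + 1 by omega]
  · -- odd column, bottom: across to the left column / from above
    have hu0 : 0 < u := by omega
    have e1 := hlt hu0; have e2 := hup h1
    have hp1 : (u - 1 - q) % 2 = 0 := by omega
    refine ⟨⟨by omega, by omega, fun k hka hk2 => off_add_step_of_ne c y ((a, true) : Fin 4 × Bool) hka⟩,
      ?_, ⟨by omega, by omega, fun k hka hk2 => off_add_step_of_ne c y ((2, false) : Fin 4 × Bool) hk2⟩,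
      ?_, trivial, trivial, fun h => h2a (congrArg Prod.fst h)⟩
    · rw [e1, hlt2]; simp [hp1, h0]
    · rw [hupa, e2]; simp [hp, show 0 < t + 1 by omega]
  · -- odd column, top: down / from the left column
    have hu0 : 0 < u := by omega
    have e1 := hdn h0; have e2 := hlt hu0
    have hp1 : (u - 1 - q) % 2 = 0 := by omega
    refine ⟨⟨by omega, by omega, fun k hka hk2 => off_add_step_of_ne c y ((2, true) : Fin 4 × Bool) hk2⟩,
      ?_, ⟨by omega, by omega, fun k hka hk2 => off_add_step_of_ne c y ((a, true) : Fin 4 × Bool) hka⟩,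
      ?_, trivial, trivial, fun h => ha (congrArg Prod.fst h)⟩
    · rw [hdna, e1]; simp [hp, show t - 1 + 1 < q by omega]
    · rw [e2, hlt2]; simp [hp1, h1]
  · -- odd column, `q ≤ 1`: impossible
    omega

/-! ## The side witness on the complement of an odd ball -/

/-- The complement of the odd ball as the complement of a corner box. -/
theorem ball_compl_eq_filter (S : ℕ) (x : TorusSite 4 (2 * S + 1)) {r : ℕ} (hr : r + 1 ≤ S) :
    (ball S x r)ᶜ = Finset.univ.filter (fun y : TorusSite 4 (2 * S + 1) =>
      ∃ i : Fin 4, 2 * r + 1 ≤ OFF (x + Torus.proj (2 * S + 1) (fun _ => -(r : ℤ))) y i) := by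
  ext y
  rw [Finset.mem_compl, mem_ball_iff x hr y, Finset.mem_filter]
  simp only [Finset.mem_univ, true_and, not_forall, not_lt]

/-- **Side witness on the complement of an odd ball** (registered `c1_sideWitness_aux10`). -/
theorem sideWitness_ball_compl (S : ℕ) (x : TorusSite 4 (2 * S + 1)) (r : ℕ) (hr1 : 1 ≤ r)
    (hr : r + 1 ≤ S) (m₀ : ℝ) :
    ∃ U : GaugeConfig 4 (2 * S + 1) (Matrix.specialUnitaryGroup (Fin 3) ℂ),
      (sideMatrix (ball S x r)ᶜ (wilsonD U m₀)).det ≠ 0 := by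
  rw [ball_compl_eq_filter S x hr]
  set c : TorusSite 4 (2 * S + 1) := x + Torus.proj (2 * S + 1) (fun _ => -(r : ℤ)) with hc
  have hq2 : (2 * r + 1) % 2 = 1 := by omega
  have hq3 : 3 ≤ 2 * r + 1 := by omega
  have hqS : 2 * r + 1 ≤ 2 * S := by omega
  have h02 : (0 : Fin 4) ≠ 2 := by decide
  have h12 : (1 : Fin 4) ≠ 2 := by decide
  have L0 := fun (y : TorusSite 4 (2 * S + 1)) (h0 : 2 * r + 1 ≤ OFF c y 0) (h2 : OFF c y 2 < 2 * r + 1) =>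
    ladder_flow c hq2 hq3 hqS h02 y rfl rfl h0 h2
  have L1 := fun (y : TorusSite 4 (2 * S + 1)) (h1 : 2 * r + 1 ≤ OFF c y 1) (h2 : OFF c y 2 < 2 * r + 1) =>
    ladder_flow c hq2 hq3 hqS h12 y rfl rfl h1 h2
  refine compl_flow_sideWitness c (2 * r + 1) m₀
    (fun y => LL 0 (2 * r + 1) (OFF c y 0) (OFF c y 2)) (fun y => LEL 0 (2 * r + 1) (OFF c y 0) (OFF c y 2))
    (fun y => LL 1 (2 * r + 1) (OFF c y 1) (OFF c y 2)) (fun y => LEL 1 (2 * r + 1) (OFF c y 1) (OFF c y 2))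
    ?_ ?_
  · intro y h0 h1 h2 h3
    obtain ⟨⟨hz0, hz2, hzk⟩, hz, ⟨hp0, hp2, hpk⟩, hp, hd, he, hne⟩ := L0 y h0 h2
    refine ⟨⟨⟨0, hz0⟩, ?_, hz2, ?_, hz⟩, ⟨⟨0, hp0⟩, ?_, hp2, ?_, hp⟩, ?_, ?_, hne⟩
    · rw [hzk 1 (by decide) (by decide)]; exact h1
    · rw [hzk 3 (by decide) (by decide)]; exact h3
    · rw [hpk 1 (by decide) (by decide)]; exact h1
    · rw [hpk 3 (by decide) (by decide)]; exact h3
    · rcases hd with h | h <;> rw [h] <;> decide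
    · rcases he with h | h <;> rw [h] <;> decide
  · intro y h1 h0 h2 h3
    obtain ⟨⟨hz1, hz2, hzk⟩, hz, ⟨hp1, hp2, hpk⟩, hp, hd, he, hne⟩ := L1 y h1 h2
    refine ⟨⟨⟨1, hz1⟩, ?_, hz2, ?_, hz⟩, ⟨⟨1, hp1⟩, ?_, hp2, ?_, hp⟩, ?_, ?_, hne⟩
    · rw [hzk 0 (by decide) (by decide)]; exact h0
    · rw [hzk 3 (by decide) (by decide)]; exact h3
    · rw [hpk 0 (by decide) (by decide)]; exact h0
    · rw [hpk 3 (by decide) (by decide)]; exact h3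
    · rcases hd with h | h <;> rw [h] <;> decide
    · rcases he with h | h <;> rw [h] <;> decide

/-- **Registered helper `c1_sideWitness_aux10` of crux stmt-QuantumFields-11512** (line `von-mises-circles`,
sub-goal `c1_sideWitness`): the side witness on the complement of an odd ball. -/
theorem c1_sideWitness_aux10 : ∀ (S : ℕ) (x : TorusSite 4 (2 * S + 1)) (r : ℕ), 1 ≤ r → r + 1 ≤ S → ∀ (m₀ : ℝ), ∃ U : GaugeConfig 4 (2 * S + 1) (Matrix.specialUnitaryGroup (Fin 3) ℂ), (sideMatrix (ball S x r)ᶜ (wilsonD U m₀)).det ≠ 0 :=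
  fun S x r hr1 hr m₀ => sideWitness_ball_compl S x r hr1 hr m₀

end Summit.QuantumFields.QCD.Theorems.VonMisesCirclesC1
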